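import Summits.ABC.StewartYu.PadicG3ParNBudgetA
import Summits.ABC.StewartYu.PadicG3ParNC
import HarnessLib

/-!
# The `𝔑`-threaded odd-`p` record `PadicG3ParN` — budget atoms, file B: orders, the unknown-count log `ℓU`,
# the rescaling allowance `AV⁺`, the `Y₀`-coefficient `L₀N(G+1)` (every `m`)

Support file (theorems only; no named facts). Cell `abc-stewartyu`, route `YuMatveevShapeRat`, crux r3 `PadicCoreOddRat`
(stmt-ABC-20503); seat p1 (record owner), for p2's `ineqPackSat_schedN_one` (STATUS 2026-08-27T19:25:51Z). With `u := (n+1)·LgV`: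
* `SdN_le_SdG_add_N`, `SdN_real_le`, `SdN_sub_SdG_real_le` — `ŜN ≤ ŜG + N ≤ LgV/4 + LgV/504 − 2` (`N·24·21ⁿ ≤ LgV`);
* `T0r_le` — p2's START order letter `T₀ʳ = (69/4)u + 2(n+1)(ŜN − ŜG) ≤ (69/4 + 1/252)·u`;
* `Thr_le` — p2's half-step threshold order `Thr = 2LgV + (n+1)(8LgV + 2ŜN) ≤ (2143/252)·u + 2LgV`;
* `ellU_le` — `ℓU = log(L₀N+1) + n·log(n·n!·N·LV+1) ≤ Zp/32 + Zp/2^31 + 1` (under `log N + log n! + 3 log n ≤ W`);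
* `SdG7_log_le` (`(ŜG+n+7)·log 2 ≤ (2/3)·yloadG`), `AVpN6_le` — `L₀N·(ŜN+n+6)·log 2 ≤ Zp/6 + Zp/8192 + n + 3`;
* `L0N_G_le` — `L₀N·(G+1) ≤ Zp/8 + G + 1`.

## References
* [Nesterenko2003] Yu. V. Nesterenko, LNM 1819 (2003) — §3.5 (3.23)–(3.24), §4.2 (4.26), (4.34).
-/

noncomputable section

open Finset Real

namespace Summit.ABC.StewartYu

namespace PadicG3ParN

open PadicG3Par (Cb cM cG two_le_Cb)

variable {n : ℕ} (P : PadicG3ParN n)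

/-! ### The depth in multiplicity units -/

/-- `ŜN ≤ ŜG + N` (`N_q = K`; `⌊log₂N⌋ + 1 ≤ N`). [folklore] -/
theorem SdN_le_SdG_add_N (hNq : P.Nq = P.K) : P.SdN ≤ P.SdG + P.N := by
  have h1 := P.SdN_le hNq
  have h2 := P.natlog_N_succ_le_N
  omega

/-- **`ŜN ≤ LgV/4 + LgV/504 − 2`** (real; `4(ŜG+2) ≤ LgV`, `N·24·21ⁿ ≤ LgV`). [folklore] -/
theorem SdN_real_le (hNq : P.Nq = P.K) (hgK : P.g ^ n ≤ (P.K : ℝ)) :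
    (P.SdN : ℝ) ≤ P.LgV / 4 + P.LgV / 504 - 2 := by
  have h1 : (P.SdN : ℝ) ≤ P.SdG + P.N := by exact_mod_cast P.SdN_le_SdG_add_N hNq
  have h2 := P.SdG_real_le_LgV
  have h3 := P.N_le_LgV_div hgK
  have h21 : (21 : ℝ) ≤ 21 ^ n := by
    calc (21 : ℝ) = 21 ^ 1 := by norm_num
      _ ≤ 21 ^ n := pow_le_pow_right₀ (by norm_num) P.hn
  have hN0 := P.N_pos
  have h4 : (P.N : ℝ) ≤ P.LgV / 504 := by
    rw [le_div_iff₀ (by norm_num)]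
    nlinarith
  linarith

/-- `ŜN − ŜG ≤ LgV/504` (real). [folklore] -/
theorem SdN_sub_SdG_real_le (hNq : P.Nq = P.K) (hgK : P.g ^ n ≤ (P.K : ℝ)) :
    (P.SdN : ℝ) - P.SdG ≤ P.LgV / 504 := by
  have h1 : (P.SdN : ℝ) ≤ P.SdG + P.N := by exact_mod_cast P.SdN_le_SdG_add_N hNq
  have h3 := P.N_le_LgV_div hgK
  have h21 : (21 : ℝ) ≤ 21 ^ n := by
    calc (21 : ℝ) = 21 ^ 1 := by norm_num
      _ ≤ 21 ^ n := pow_le_pow_right₀ (by norm_num) P.hn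
  have hN0 := P.N_pos
  have h4 : (P.N : ℝ) ≤ P.LgV / 504 := by
    rw [le_div_iff₀ (by norm_num)]
    nlinarith
  linarith

/-! ### The two order letters of the saturated pack -/

/-- **p2's START order letter**: `(69/4)(n+1)LgV + 2(n+1)(ŜN − ŜG) ≤ (69/4 + 1/252)·(n+1)·LgV`. [folklore] -/
theorem T0r_le (hNq : P.Nq = P.K) (hgK : P.g ^ n ≤ (P.K : ℝ)) :
    (69 / 4) * ((n : ℝ) + 1) * P.LgV + 2 * ((n : ℝ) + 1) * ((P.SdN : ℝ) - P.SdG) ≤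
      (69 / 4 + 1 / 252) * (((n : ℝ) + 1) * P.LgV) := by
  have h := P.SdN_sub_SdG_real_le hNq hgK
  have hn : (0 : ℝ) ≤ (n : ℝ) + 1 := by positivity
  nlinarith [mul_le_mul_of_nonneg_left h hn]

/-- **p2's half-step threshold order**: `2LgV + (n+1)(8LgV + 2ŜN) ≤ (2143/252)·(n+1)·LgV + 2·LgV`
(`2ŜN ≤ LgV/2 + LgV/252 − 4`). [folklore] -/
theorem Thr_le (hNq : P.Nq = P.K) (hgK : P.g ^ n ≤ (P.K : ℝ)) :
    2 * (P.LgV : ℝ) + ((n : ℝ) + 1) * (8 * P.LgV + 2 * P.SdN) ≤ (2143 / 252) * (((n : ℝ) + 1) * P.LgV) + 2 * P.LgV := by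
  have h := P.SdN_real_le hNq hgK
  have hn : (0 : ℝ) ≤ (n : ℝ) + 1 := by positivity
  nlinarith [mul_le_mul_of_nonneg_left h hn]

/-! ### The unknown-count logarithm -/

/-- **`ℓU = log(L₀N+1) + n·log(n·n!·N·LV+1) ≤ Zp/32 + Zp/2^31 + 1`** under the budget letter's floor
`log N + log n! + 3 log n ≤ W` (`log(L₀N+1) + n log(2LV) ≤ lunkV ≤ Zp/32 + 1`, `n·W ≤ (n+1)·W_LV ≤ Zp/2^31`). [folklore] -/
theorem ellU_le (hNCW : Real.log P.N + Real.log (n.factorial : ℝ) + 3 * Real.log n ≤ P.W) :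
    Real.log ((P.L0N : ℝ) + 1) + n * Real.log ((n : ℝ) * (n.factorial : ℝ) * (P.N : ℝ) * (P.LV : ℝ) + 1) ≤
      P.Zp / 32 + P.Zp / 2 ^ 31 + 1 := by
  have hlunk := P.lunkV_le
  unfold PadicG3Par.lunkV at hlunk
  have hL0 : (P.L0N : ℝ) ≤ P.L0V := by exact_mod_cast P.L0N_le_L0V
  have hN1 := P.one_le_N
  have hLV1 := P.one_le_LV
  have hn1 : (1 : ℝ) ≤ n := by exact_mod_cast P.hn
  have hfac1 : (1 : ℝ) ≤ (n.factorial : ℝ) := by exact_mod_cast Nat.one_le_iff_ne_zero.mpr (Nat.factorial_ne_zero n)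
  have hlogn : 0 ≤ Real.log (n : ℝ) := Real.log_nonneg hn1
  -- `x := n·n!·N·LV ≥ 1`, `log(x+1) ≤ log 2 + log n + log n! + log N + log LV`
  have hx1 : (1 : ℝ) ≤ (n : ℝ) * (n.factorial : ℝ) * P.N * P.LV := by
    have h1 : (1 : ℝ) ≤ (n : ℝ) * (n.factorial : ℝ) := one_le_mul_of_one_le_of_one_le hn1 hfac1
    have h2 : (1 : ℝ) ≤ (n : ℝ) * (n.factorial : ℝ) * P.N := one_le_mul_of_one_le_of_one_le h1 hN1
    exact one_le_mul_of_one_le_of_one_le h2 hLV1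
  have hlogx : Real.log ((n : ℝ) * (n.factorial : ℝ) * P.N * P.LV + 1) ≤
      Real.log 2 + Real.log n + Real.log (n.factorial : ℝ) + Real.log P.N + Real.log P.LV := by
    have h2x : (n : ℝ) * (n.factorial : ℝ) * P.N * P.LV + 1 ≤ 2 * ((n : ℝ) * (n.factorial : ℝ) * P.N * P.LV) := by linarith
    calc Real.log ((n : ℝ) * (n.factorial : ℝ) * P.N * P.LV + 1)
        ≤ Real.log (2 * ((n : ℝ) * (n.factorial : ℝ) * P.N * P.LV)) := Real.log_le_log (by linarith) h2x
      _ = Real.log 2 + Real.log n + Real.log (n.factorial : ℝ) + Real.log P.N + Real.log P.LV := by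
          rw [Real.log_mul (by norm_num) (by positivity), Real.log_mul (by positivity) (by positivity),
            Real.log_mul (by positivity) (by positivity), Real.log_mul (by positivity) (by positivity)]
          ring
  -- `log 2 + log LV = log(2 LV)`
  have hlog2LV : Real.log 2 + Real.log P.LV = Real.log (2 * (P.LV : ℝ)) := by
    rw [Real.log_mul (by norm_num) (by positivity)]
  -- `n·W ≤ (n+1)·W_LV ≤ Zp/2^31`
  have hWWLV : P.W ≤ P.WLV := by
    have h := P.W_add_log_le_WLV
    have : 0 ≤ Real.log (2 * (P.LV : ℝ)) := Real.log_nonneg (by linarith)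
    linarith
  have hW1 := P.hW
  have hsW := P.succ_LgV_WLV_le
  have hg1 := P.one_le_g
  have hZ := P.Zp_facts.1
  have hLg : (2 : ℝ) ^ 25 ≤ P.LgV := by
    have h1 : 2 ^ 25 ≤ 2 ^ (n + 25) := Nat.pow_le_pow_right (by norm_num) (by omega)
    exact_mod_cast h1.trans P.two_pow_le_LgV
  have hnW : (n : ℝ) * P.W ≤ P.Zp / 2 ^ 31 := by
    -- `(n+1) LgV WLV ≤ Zp/(64 g) ≤ Zp/64`, `LgV ≥ 2^25`
    have h1 : P.Zp / (64 * P.g) ≤ P.Zp / 64 := by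
      apply div_le_div_of_nonneg_left hZ.le (by norm_num); nlinarith
    have h2 : ((n : ℝ) + 1) * P.LgV * P.WLV ≤ P.Zp / 64 := hsW.trans h1
    have hWL0 : 0 ≤ P.WLV := by linarith
    have h3 : (n : ℝ) * P.W * 2 ^ 25 ≤ ((n : ℝ) + 1) * P.LgV * P.WLV := by
      have : (n : ℝ) * P.W ≤ (n + 1) * P.WLV := by nlinarith
      nlinarith [mul_le_mul this hLg (by positivity) (by positivity)]
    rw [le_div_iff₀ (by positivity)]
    have e : (2 : ℝ) ^ 31 = 2 ^ 25 * 64 := by norm_num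
    rw [e]; nlinarith
  -- `log(L0N+1) ≤ log(L0V+1)`
  have hlogL : Real.log ((P.L0N : ℝ) + 1) ≤ Real.log ((P.L0V : ℝ) + 1) :=
    Real.log_le_log (by positivity) (by linarith)
  have hn0 : (0 : ℝ) ≤ n := by linarith
  have hmul := mul_le_mul_of_nonneg_left hlogx hn0
  nlinarith [hmul, hlogL, hlunk, hnW, mul_le_mul_of_nonneg_left hNCW hn0, mul_nonneg hn0 hlogn]

/-! ### The rescaling allowance `AV⁺` and the `Y₀`-coefficient -/

/-- **`(ŜG + n + 7)·log 2 ≤ (2/3)·yloadG`** (`N_q = K`, `½ ≤ θ₀`; every `m`). [folklore] -/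
theorem SdG7_log_le (hNq : P.Nq = P.K) (hθ : 1 / 2 ≤ P.θ₀) :
    ((P.SdG : ℝ) + n + 7) * Real.log 2 ≤ (2 / 3) * P.yloadG := by
  have h2pow := P.two_pow_SdG_le
  have hK := P.log_K_le_G_add
  have hlgg := P.lgg_log_two_lt
  have hg1 := P.one_le_g
  have hg : 0 < P.g := by linarith
  have hlogg : Real.log P.g ≤ P.g - 1 := Real.log_le_sub_one_of_pos hg
  have hGg := P.G_eq_mul_g
  have hlogp := P.log_p_pos
  have hKpos := P.K_pos
  have hn1 : (1 : ℝ) ≤ n := by exact_mod_cast P.hn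
  have hl2 : (0.6931471803 : ℝ) < Real.log 2 := Real.log_two_gt_d9
  have hl2' : Real.log 2 < 0.6931471808 := Real.log_two_lt_d9
  have hlogn : 0 ≤ Real.log ((n : ℝ) + 1) := Real.log_nonneg (by linarith)
  have hlog4 : Real.log 4 = 2 * Real.log 2 := by
    rw [show (4 : ℝ) = 2 ^ 2 by norm_num, Real.log_pow]; push_cast; ring
  -- `ŜG log 2 ≤ (n+24) log 2 + log K + lgg log 2`
  have h1 : (P.SdG : ℝ) * Real.log 2 ≤ (n + 24) * Real.log 2 + Real.log P.K + P.lgg * Real.log 2 := by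
    have h : ((2 ^ P.SdG : ℕ) : ℝ) ≤ ((2 ^ (n + 24) * P.Nq * 2 ^ P.lgg : ℕ) : ℝ) := by exact_mod_cast h2pow
    rw [hNq] at h
    push_cast at h
    have hlog := Real.log_le_log (by positivity) h
    rw [Real.log_pow, Real.log_mul (by positivity) (by positivity), Real.log_mul (by positivity) (by positivity),
      Real.log_pow, Real.log_pow] at hlog
    push_cast at hlog
    linarith
  -- linear pieces
  have hθ' : (1 - P.θ₀) * Real.log P.p ≤ Real.log P.p / 2 := by nlinarith
  have hA : (P.SdG : ℝ) * Real.log 2 ≤ (n + 26) * Real.log 2 + P.G + Real.log P.p / 2 + (P.g - 1) := by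
    nlinarith
  have hnl : (n : ℝ) * Real.log 2 ≤ 0.6931471808 * n := by nlinarith
  have hG7 : (8 * (n : ℝ) + 7) * 1 ≤ (8 * n + 7) * P.g := by nlinarith
  have hlp2 := P.log_two_le_log_p
  unfold PadicG3Par.yloadG
  nlinarith [hA, hnl, hG7, hGg, hlp2, hl2, hl2', hlogn]

/-- **`AV⁺ = L₀N·(ŜN+n+6)·log 2 ≤ Zp/6 + Zp/8192 + n + 3`** (`L₀N ≤ Zp/(4N·yloadG) + 1`, `ŜN ≤ ŜG + N`,
`(ŜG+n+6+N)/N ≤ ŜG+n+7`, `(ŜG+n+7) log 2 ≤ (2/3) yloadG`; every `m`). [cite: Nesterenko2003, §4.2 (4.26)] -/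
theorem AVpN6_le (hNq : P.Nq = P.K) (hθ : 1 / 2 ≤ P.θ₀) (hgK : P.g ^ n ≤ (P.K : ℝ)) :
    (P.L0N : ℝ) * ((P.SdN + n + 6) * Real.log 2) ≤ P.Zp / 6 + P.Zp / 8192 + n + 3 := by
  have hL := P.L0N_le'
  have hS : (P.SdN : ℝ) ≤ P.SdG + P.N := by exact_mod_cast P.SdN_le_SdG_add_N hNq
  have hSr := P.SdN_real_le hNq hgK
  have h7 := P.SdG7_log_le hNq hθ
  have hN1 := P.one_le_N
  have hN0 := P.N_pos
  have hy := P.yloadG_pos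
  have hZ := P.Zp_facts.1
  obtain ⟨_, _, hLgZ, _, _⟩ := P.tinyV
  have hl2 : (0.6931471803 : ℝ) < Real.log 2 := Real.log_two_gt_d9
  have hl2' : Real.log 2 < 0.6931471808 := Real.log_two_lt_d9
  have hl20 : 0 < Real.log 2 := by linarith
  have hSdG0 : (0 : ℝ) ≤ P.SdG := Nat.cast_nonneg _
  have hn0 : (0 : ℝ) ≤ n := Nat.cast_nonneg _
  have hL0 : (0 : ℝ) ≤ P.L0N := Nat.cast_nonneg _
  -- the main product: `(Zp/(4N yloadG)) · (ŜG + N + n + 6) log 2 ≤ Zp (ŜG+n+7) log 2/(4 yloadG) ≤ Zp/6`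
  have hc : ((P.SdN : ℝ) + n + 6) * Real.log 2 ≤ ((P.SdG : ℝ) + P.N + n + 6) * Real.log 2 := by nlinarith
  have hc0 : 0 ≤ ((P.SdN : ℝ) + n + 6) * Real.log 2 := by positivity
  have hmain : P.Zp / (4 * P.N * P.yloadG) * (((P.SdG : ℝ) + P.N + n + 6) * Real.log 2) ≤ P.Zp / 6 := by
    -- `(ŜG + N + n + 6) ≤ N (ŜG + n + 7)` and `(ŜG+n+7) log 2 ≤ (2/3) yloadG`
    have h1 : (P.SdG : ℝ) + P.N + n + 6 ≤ P.N * (P.SdG + n + 7) := by nlinarith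
    have h2 : ((P.SdG : ℝ) + P.N + n + 6) * Real.log 2 ≤ P.N * ((2 / 3) * P.yloadG) := by
      calc ((P.SdG : ℝ) + P.N + n + 6) * Real.log 2 ≤ P.N * (P.SdG + n + 7) * Real.log 2 :=
            mul_le_mul_of_nonneg_right h1 hl20.le
        _ = P.N * ((P.SdG + n + 7) * Real.log 2) := by ring
        _ ≤ P.N * ((2 / 3) * P.yloadG) := mul_le_mul_of_nonneg_left h7 hN0.le
    calc P.Zp / (4 * P.N * P.yloadG) * (((P.SdG : ℝ) + P.N + n + 6) * Real.log 2)
        ≤ P.Zp / (4 * P.N * P.yloadG) * (P.N * ((2 / 3) * P.yloadG)) :=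
          mul_le_mul_of_nonneg_left h2 (by positivity)
      _ = P.Zp / 6 := by field_simp; ring
  -- the `+1` part: `(ŜG + N + n + 6) log 2 ≤ (LgV/4 + LgV/504 − 2 + n + 6)·log 2 ≤ Zp/8192 + n + 3`
  have hrest : ((P.SdG : ℝ) + P.N + n + 6) * Real.log 2 ≤ P.Zp / 8192 + n + 3 := by
    have h1 : (P.SdG : ℝ) + P.N ≤ P.LgV / 4 + P.LgV / 504 - 2 := by
      have := P.SdG_real_le_LgV
      have h3 := P.N_le_LgV_div hgK
      have h21 : (21 : ℝ) ≤ 21 ^ n := by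
        calc (21 : ℝ) = 21 ^ 1 := by norm_num
          _ ≤ 21 ^ n := pow_le_pow_right₀ (by norm_num) P.hn
      have h4 : (P.N : ℝ) ≤ P.LgV / 504 := by
        rw [le_div_iff₀ (by norm_num)]; nlinarith
      linarith
    nlinarith
  calc (P.L0N : ℝ) * ((P.SdN + n + 6) * Real.log 2)
      ≤ (P.Zp / (4 * P.N * P.yloadG) + 1) * (((P.SdG : ℝ) + P.N + n + 6) * Real.log 2) :=
        mul_le_mul hL hc hc0 (by positivity)
    _ = P.Zp / (4 * P.N * P.yloadG) * (((P.SdG : ℝ) + P.N + n + 6) * Real.log 2) +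
          ((P.SdG : ℝ) + P.N + n + 6) * Real.log 2 := by ring
    _ ≤ P.Zp / 6 + (P.Zp / 8192 + n + 3) := add_le_add hmain hrest
    _ = _ := by ring

/-- **`L₀N·(G+1) ≤ Zp/8 + G + 1`** (`L₀N ≤ Zp/(4N yloadG) + 1`, `yloadG ≥ 2G + 25 ≥ 2(G+1)`; every `m`). [folklore] -/
theorem L0N_G_le (hNq : P.Nq = P.K) (hK₀ : (P.p : ℝ) - 1 ≤ P.K₀) :
    (P.L0N : ℝ) * (P.G + 1) ≤ P.Zp / 8 + P.G + 1 := by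
  have hL := P.L0N_le'
  have hy := P.yloadG_ge' hNq hK₀
  have hN1 := P.one_le_N
  have hN0 := P.N_pos
  have hZ := P.Zp_facts.1
  have hG : 0 < P.G := by linarith [P.eight_le_G]
  have hypos := P.yloadG_pos
  have h1 : P.Zp / (4 * P.N * P.yloadG) ≤ P.Zp / (4 * P.yloadG) := by
    apply div_le_div_of_nonneg_left hZ.le (by positivity); nlinarith
  have h2 : P.Zp / (4 * P.yloadG) * (P.G + 1) ≤ P.Zp / 8 := by
    rw [div_mul_eq_mul_div, div_le_div_iff₀ (by positivity) (by norm_num)]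
    nlinarith
  have hG1 : 0 ≤ P.G + 1 := by linarith
  nlinarith [mul_le_mul_of_nonneg_right (hL.trans (by linarith : P.Zp / (4 * P.N * P.yloadG) + 1 ≤ P.Zp / (4 * P.yloadG) + 1)) hG1]

end PadicG3ParN

end Summit.ABC.StewartYu
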